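import Literature.Combinatorics.StablePolynomials.JensenMultipliers
import Literature.Combinatorics.StablePolynomials.StabilityPreserversAllDegrees
import Literature.Combinatorics.StablePolynomials.MasterCompositionMultivariate
import HarnessLib

/-!
# Generalized Jensen multipliers preserve stability (Borcea–Brändén I, Lemma 5.2, every number of variables)

J. Borcea, P. Brändén, *The Lee–Yang and Pólya–Schur programs. I. Linear operators preserving stability*,
Invent. Math. 177 (2009) 541–569 (arXiv:0809.0401), §5.1:

> For `α, β ∈ ℕⁿ` let `J(α, β) = (β)_α β^{-α}` (we use the convention that `k^{±k} = 1` for `k = 0`), where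
> `(β)_α = β!/(β-α)!` if `α ≤ β` and `0` otherwise.
>
> **Lemma 5.2.** Let `β ∈ ℕⁿ`. The linear operators on `ℂ[z_1,…,z_n]` defined by
> `z^α ↦ J(α, β) z^α` and `z^α ↦ (β)_α z^α`, `α ∈ ℕⁿ`, preserve stability.
>
> *Proof.* Fix `β ∈ ℕⁿ`. Since the first operator is a composition of the second operator and a rescaling
> of the variables, it is enough to prove the lemma only for the second operator – call it `T` and denote by
> `T_κ` its restriction to `ℂ_κ[z_1,…,z_n]`, where `κ ∈ ℕⁿ`. By Theorem 1.1 we need to show that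
> `G_{T_κ}(z,w) = T_κ[(z+w)^κ] = Σ_{α ≤ κ} binom(κ,α) (β)_α z^α w^{κ-α}` is stable for all `κ ∈ ℕⁿ`. However,
> `G_{T_κ}(z,w) = Π_{i=1}^n [Σ_{j=0}^{κ_i} j! binom(κ_i,j) binom(β_i,j) z_i^j w_i^{κ_i-j}]`, so the lemma
> amounts to showing that for any `m, n ∈ ℕ` the univariate polynomial `g(t) = Σ_j j! binom(n,j) binom(m,j) t^j`
> is real-rooted (then necessarily with all negative roots).

The one-variable ingredient — `g` has only real zeros `≤ 0` — is the tree's `binomialForm_descFactorial_roots`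
(`JensenMultipliers.lean`, obtained there exactly as printed, from `S = (1 + d/dt)^n`). This file carries out the
multivariate step of the printed proof: for a *product* multiplier `z^α ↦ (Π_i c_i(α_i)) z^α` the symbol
factorises, `T[(z+w)^κ](z) = Π_i Σ_j binom(κ_i,j) c_i(j) z_i^j w_i^{κ_i-j}` (`eval_mvMultiplierOp_prod`), each factor
is the symbol of the univariate diagonal operator `Λ_{c_i}` on `ℂ_{κ_i}[t]` and does not vanish on `ℋ × ℋ` when
`Σ_j binom(κ_i,j) c_i(j) t^j` has only real non-positive zeros (tree `symbol_multiplierOp_ne_zero`), and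
Theorem 1.1 for every `κ ∈ ℕⁿ` (tree `BorceaBranden_stabilityPreserver_iff'`), applied with `κ_i = deg_{z_i} p`,
gives "stable or identically zero" for every stable `p` (`mvMultiplierOp_prod_stable_or_zero`). With
`c_i(j) = (β_i)_j` this is Lemma 5.2 for the second operator (`descFactorialOp_stable_or_zero`); the first operator
is the second one composed with the rescaling `z_i ↦ z_i/β_i` (`β_i ≥ 1`; `jensenOp_eq_comp`), and rescaling by
positive reals preserves stability (tree `IsUpperHalfPlaneStable.diagScale`), whence `jensenOp_stable_or_zero`.
Since all multipliers are real, the same operators preserve real stability (`§5`, via the tree's `complexify`).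

As everywhere in the tree, "preserves stability" is spelled out: `T f` is stable or `T f = 0` for every stable `f`
(Borcea–Brändén's convention, Introduction of the paper).

## Contents

* §1 `mvMultiplierOp b` (`z^α ↦ b(α) z^α`): `mvMultiplierOp_monomial`, `mvMultiplierOp_prod_X_pow`,
  `eval_mvMultiplierOp_prod_X_add_C_pow` (the symbol), `eval_mvMultiplierOp_prod` (factorisation for product
  multipliers), `mvMultiplierOp_prod_stable_or_zero_of_degreeOf_le`, **`mvMultiplierOp_prod_stable_or_zero`**.
* §2 `multiDescFactorial β α = (β)_α`, `descFactorialOp β`; **`descFactorialOp_stable_or_zero`** (Lemma 5.2, second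
  operator).
* §3 `scaleOp c` (`z_i ↦ c_i z_i`): `scaleOp_monomial`, `isUpperHalfPlaneStable_scaleOp`, `mvMultiplierOp_comp_scaleOp`.
* §4 `jensenJ R α β = J(α,β)`, `jensenScale`, `jensenOp R β`; `jensenJ_eq_mul_prod`, `jensenOp_eq_comp`, **`jensenOp_stable_or_zero`**
  (Lemma 5.2, first operator).
* §5 real coefficients: `complexify_mvMultiplierOp`, `isRealStable_mvMultiplierOp_or_zero`,
  `descFactorialOp_realStable_or_zero`, `jensenOp_realStable_or_zero`.

## References

* [BorceaBranden2009] J. Borcea, P. Brändén, Invent. Math. 177 (2009) 541–569, §5.1 Lemma 5.2 and its proof;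
  §1.1 Thm. 1.1; §1 Lemma 1.7 (2).
-/

noncomputable section

open MvPolynomial Finset

namespace Literature.Combinatorics.StablePolynomials

variable {τ : Type*}

/-! ## §1 Diagonal (multiplier) operators `z^α ↦ b(α) z^α` and product multipliers -/

section Multiplier

/-- **The diagonal operator `z^α ↦ b(α) z^α` on `R[z_τ]`** determined by a multiplier family `b : ℕ^τ → R`
(the operators of Lemma 5.2 are of this form with `b(α) = (β)_α`, resp. `b(α) = J(α,β)`).
[cite: BorceaBranden2009, §5.1 Lemma 5.2 ("the linear operators on `ℂ[z_1,…,z_n]` defined by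
`z^α ↦ J(α,β) z^α` and `z^α ↦ (β)_α z^α`")] -/
def mvMultiplierOp {R : Type*} [CommSemiring R] (b : (τ →₀ ℕ) → R) : MvPolynomial τ R →ₗ[R] MvPolynomial τ R :=
  (basisMonomials τ R).constr R fun s => b s • monomial s 1

/-- `z^α ↦ b(α) z^α` on monomials: `c z^s ↦ b(s) c z^s`. [cite: BorceaBranden2009, §5.1 Lemma 5.2] -/
theorem mvMultiplierOp_monomial {R : Type*} [CommSemiring R] (b : (τ →₀ ℕ) → R) (s : τ →₀ ℕ) (c : R) :
    mvMultiplierOp b (monomial s c) = monomial s (b s * c) := by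
  have h : (monomial s c : MvPolynomial τ R) = c • basisMonomials τ R s := by
    rw [coe_basisMonomials, smul_monomial, smul_eq_mul, mul_one]
  rw [h, map_smul, mvMultiplierOp, Module.Basis.constr_basis, smul_monomial, smul_monomial, smul_eq_mul,
    smul_eq_mul, mul_one, mul_comm]

variable [Fintype τ]

/-- `z^α ↦ b(α) z^α` on `z^m = Π_i z_i^{m_i}`. [cite: BorceaBranden2009, §5.1 Lemma 5.2] -/
theorem mvMultiplierOp_prod_X_pow (b : (τ →₀ ℕ) → ℂ) (m : τ → ℕ) :
    mvMultiplierOp b (∏ i, X i ^ m i : MvPolynomial τ ℂ) = b (toF m) • ∏ i, X i ^ m i := by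
  rw [prod_X_pow_eq_monomial_toF, mvMultiplierOp_monomial, smul_monomial, smul_eq_mul]

variable [DecidableEq τ]

/-- **The symbol of a diagonal operator**: `T[(z+w)^κ](z) = Σ_{α ≤ κ} b(α) Π_i binom(κ_i,α_i) z_i^{α_i} w_i^{κ_i-α_i}`.
[cite: BorceaBranden2009, §5.1 proof of Lemma 5.2 ("`G_{T_κ}(z,w) = T_κ[(z+w)^κ] = Σ_{α≤κ} binom(κ,α) (β)_α
z^α w^{κ-α}`")] -/
theorem eval_mvMultiplierOp_prod_X_add_C_pow (b : (τ →₀ ℕ) → ℂ) (κ : τ → ℕ) (z w : τ → ℂ) :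
    eval z (mvMultiplierOp b (∏ i, (X i + C (w i)) ^ κ i)) =
      ∑ α ∈ Fintype.piFinset (fun i => range (κ i + 1)),
        b (toF α) * ∏ i, ((((κ i).choose (α i) : ℕ) : ℂ) * z i ^ α i * w i ^ (κ i - α i)) := by
  rw [apply_prod_X_add_C_pow, map_sum]
  refine sum_congr rfl fun α _ => ?_
  rw [smul_eval, mvMultiplierOp_prod_X_pow, smul_eval, _root_.map_prod]
  simp only [map_pow, eval_X]
  rw [mul_left_comm, ← prod_mul_distrib]
  exact congrArg (b (toF α) * ·) (prod_congr rfl fun i _ => by ring)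

/-- **For a product multiplier `b(α) = Π_i c_i(α_i)` the symbol factorises**:
`T[(z+w)^κ](z) = Π_i [Σ_{j ≤ κ_i} binom(κ_i,j) c_i(j) z_i^j w_i^{κ_i-j}]`. [cite: BorceaBranden2009, §5.1 proof of
Lemma 5.2 ("`G_{T_κ}(z,w) = Π_{i=1}^n [Σ_{j=0}^{κ_i} j! binom(κ_i,j) binom(β_i,j) z_i^j w_i^{κ_i-j}]`")] -/
theorem eval_mvMultiplierOp_prod (c : τ → ℕ → ℂ) (κ : τ → ℕ) (z w : τ → ℂ) :
    eval z (mvMultiplierOp (fun s => ∏ i, c i (s i)) (∏ i, (X i + C (w i)) ^ κ i)) =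
      ∏ i, ∑ j ∈ range (κ i + 1), (((κ i).choose j : ℕ) : ℂ) * c i j * z i ^ j * w i ^ (κ i - j) := by
  rw [eval_mvMultiplierOp_prod_X_add_C_pow, prod_univ_sum]
  refine sum_congr rfl fun α _ => ?_
  simp only [toF_apply]
  rw [← prod_mul_distrib]
  exact prod_congr rfl fun i _ => by ring

/-- **Product multipliers preserve stability on `ℂ_κ[z_τ]`** when, for every `i`, the univariate polynomial
`Σ_{j ≤ κ_i} binom(κ_i,j) c_i(j) t^j` has only real non-positive zeros: the symbol is a product of univariate
symbols `w_i^{κ_i} q_i(z_i/w_i)` without zeros on `ℋ × ℋ` (the mechanism of the printed proof of Lemma 5.2, via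
Theorem 1.1). [cite: BorceaBranden2009, §5.1 proof of Lemma 5.2] [cite: BorceaBranden2009, §1.1 Thm. 1.1] -/
theorem mvMultiplierOp_prod_stable_or_zero_of_degreeOf_le {c : τ → ℕ → ℂ} {κ : τ → ℕ}
    (hc : ∀ (i : τ) (t : ℂ), (binomialForm (κ i) (c i)).eval t = 0 → t.im = 0 ∧ t.re ≤ 0)
    {p : MvPolynomial τ ℂ} (hp : ∀ i, degreeOf i p ≤ κ i) (hs : IsUpperHalfPlaneStable p) :
    IsUpperHalfPlaneStable (mvMultiplierOp (fun s => ∏ i, c i (s i)) p) ∨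
      mvMultiplierOp (fun s => ∏ i, c i (s i)) p = 0 := by
  have hG : IsUpperHalfPlaneStable (boundedDegreeSymbol κ (mvMultiplierOp fun s => ∏ i, c i (s i))) :=
    (isUpperHalfPlaneStable_boundedDegreeSymbol_iff κ _).2 fun z w hz hw => by
      rw [eval_mvMultiplierOp_prod]
      exact prod_ne_zero_iff.2 fun i _ => symbol_multiplierOp_ne_zero (hc i) (hz i) (hw i)
  exact (BorceaBranden_stabilityPreserver_iff' κ _).2 (Or.inr hG) p hp hs

/-- **Product multipliers preserve stability on all of `ℂ[z_τ]`** when, for every `i` and every `n`, the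
polynomial `Σ_{j ≤ n} binom(n,j) c_i(j) t^j` has only real non-positive zeros: for every stable `p`,
`Σ_α (Π_i c_i(α_i)) a_α z^α` is stable or identically zero (take `κ_i = deg_{z_i} p`: "`T` preserves stability if
and only if the same holds for all its restrictions `T_κ`"). [cite: BorceaBranden2009, §5.1 proof of Lemma 5.2]
[cite: BorceaBranden2009, §5 (first paragraph) and §1.1 Thm. 1.1] -/
theorem mvMultiplierOp_prod_stable_or_zero {c : τ → ℕ → ℂ}
    (hc : ∀ (i : τ) (n : ℕ) (t : ℂ), (binomialForm n (c i)).eval t = 0 → t.im = 0 ∧ t.re ≤ 0)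
    {p : MvPolynomial τ ℂ} (hs : IsUpperHalfPlaneStable p) :
    IsUpperHalfPlaneStable (mvMultiplierOp (fun s => ∏ i, c i (s i)) p) ∨
      mvMultiplierOp (fun s => ∏ i, c i (s i)) p = 0 :=
  mvMultiplierOp_prod_stable_or_zero_of_degreeOf_le (κ := fun i => degreeOf i p) (fun i => hc i _)
    (fun _ => le_rfl) hs

end Multiplier

/-! ## §2 The multipliers `(β)_α` — Lemma 5.2, second operator -/

section DescFactorial

variable [Fintype τ]

/-- **`(β)_α = β!/(β-α)!` if `α ≤ β` and `0` otherwise** (`β! = Π_i β_i!`), i.e. `Π_i (β_i)_{α_i}` with the falling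
factorial `(m)_k = m(m-1)⋯(m-k+1)`. [cite: BorceaBranden2009, §5 (display before Thm. 5.1, definition of `(β)_α`)] -/
def multiDescFactorial (β α : τ → ℕ) : ℕ :=
  ∏ i, (β i).descFactorial (α i)

/-- `(β)_α = 0` unless `α ≤ β`. [cite: BorceaBranden2009, §5 (definition of `(β)_α`, "0 otherwise")] -/
theorem multiDescFactorial_eq_zero {β α : τ → ℕ} (h : ¬ α ≤ β) : multiDescFactorial β α = 0 := by
  obtain ⟨i, hi⟩ : ∃ i, β i < α i := by simpa only [Pi.le_def, not_forall, not_le] using h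
  exact prod_eq_zero (mem_univ i) (Nat.descFactorial_eq_zero_iff_lt.2 hi)

/-- `(β)_α = β!/(β-α)! = Π_i β_i!/(β_i-α_i)!` for `α ≤ β`. [cite: BorceaBranden2009, §5 (definition of `(β)_α`)] -/
theorem multiDescFactorial_eq_prod_div {β α : τ → ℕ} (h : α ≤ β) :
    multiDescFactorial β α = ∏ i, (β i).factorial / (β i - α i).factorial :=
  prod_congr rfl fun i _ => Nat.descFactorial_eq_div (h i)

/-- `(β)_α ≠ 0` for `α ≤ β`. [cite: BorceaBranden2009, §5 (definition of `(β)_α`)] -/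
theorem multiDescFactorial_ne_zero {β α : τ → ℕ} (h : α ≤ β) : multiDescFactorial β α ≠ 0 :=
  prod_ne_zero_iff.2 fun i _ => fun h0 => (not_lt.2 (h i)) (Nat.descFactorial_eq_zero_iff_lt.1 h0)

/-- **The second operator of Lemma 5.2, `z^α ↦ (β)_α z^α`** (over any coefficient semiring `R`).
[cite: BorceaBranden2009, §5.1 Lemma 5.2 (second operator)] -/
def descFactorialOp (R : Type*) [CommSemiring R] (β : τ → ℕ) : MvPolynomial τ R →ₗ[R] MvPolynomial τ R :=
  mvMultiplierOp fun s => ∏ i, (((β i).descFactorial (s i) : ℕ) : R)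

/-- `z^α ↦ (β)_α z^α` on monomials. [cite: BorceaBranden2009, §5.1 Lemma 5.2 (second operator)] -/
theorem descFactorialOp_monomial (R : Type*) [CommSemiring R] (β : τ → ℕ) (s : τ →₀ ℕ) (c : R) :
    descFactorialOp R β (monomial s c) = monomial s ((multiDescFactorial β ⇑s : ℕ) * c) := by
  rw [descFactorialOp, mvMultiplierOp_monomial, multiDescFactorial, Nat.cast_prod]

variable [DecidableEq τ]

/-- **Borcea–Brändén I, Lemma 5.2 (second operator), every number of variables: `z^α ↦ (β)_α z^α` preserves
stability** — for every `β ∈ ℕ^τ` and every stable `p ∈ ℂ[z_τ]`, `Σ_α (β)_α a_α z^α` is stable or identically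
zero. [cite: BorceaBranden2009, §5.1 Lemma 5.2] -/
theorem descFactorialOp_stable_or_zero (β : τ → ℕ) {p : MvPolynomial τ ℂ} (hs : IsUpperHalfPlaneStable p) :
    IsUpperHalfPlaneStable (descFactorialOp ℂ β p) ∨ descFactorialOp ℂ β p = 0 :=
  mvMultiplierOp_prod_stable_or_zero (c := fun i k => (((β i).descFactorial k : ℕ) : ℂ))
    (fun i n t ht => binomialForm_descFactorial_roots n (β i) t ht) hs

end DescFactorial

/-! ## §3 Rescaling the variables -/

section Scale

/-- **The rescaling `z_i ↦ c_i z_i`** (`c ∈ ℝ^τ`) as an algebra endomorphism of `ℂ[z_τ]`.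
[cite: BorceaBranden2009, §5.1 proof of Lemma 5.2 ("a rescaling of the variables")] -/
def scaleOp (c : τ → ℝ) : MvPolynomial τ ℂ →ₐ[ℂ] MvPolynomial τ ℂ :=
  bind₁ fun i => C ((c i : ℝ) : ℂ) * X i

/-- Rescaling by positive reals preserves stability (tree `IsUpperHalfPlaneStable.diagScale`).
[cite: BorceaBranden2009, §1 Lemma 1.7 (2)] -/
theorem isUpperHalfPlaneStable_scaleOp {c : τ → ℝ} (hc : ∀ i, 0 < c i) {p : MvPolynomial τ ℂ}
    (hp : IsUpperHalfPlaneStable p) : IsUpperHalfPlaneStable (scaleOp c p) :=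
  hp.diagScale hc

variable [Fintype τ]

/-- `z^s ↦ c^s z^s` with `c^s = Π_i c_i^{s_i}`. [cite: BorceaBranden2009, §5.1 proof of Lemma 5.2] -/
theorem scaleOp_monomial (c : τ → ℝ) (s : τ →₀ ℕ) (a : ℂ) :
    scaleOp c (monomial s a) = (∏ i, ((c i : ℝ) : ℂ) ^ s i) • monomial s a := by
  have hmon : (monomial s a : MvPolynomial τ ℂ) = C a * ∏ i, X i ^ s i := by
    rw [prod_X_pow_eq_monomial_toF, toF_coe, C_mul_monomial, mul_one]
  rw [hmon, scaleOp, map_mul, bind₁_C_right, _root_.map_prod]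
  simp only [map_pow, bind₁_X_right, mul_pow]
  simp only [← C_pow]
  rw [prod_mul_distrib, ← _root_.map_prod C, smul_eq_C_mul]
  ring

/-- **A diagonal operator composed with a rescaling is diagonal**: `(z^α ↦ b(α) z^α) ∘ (z_i ↦ c_i z_i)` is
`z^α ↦ b(α) c^α z^α`. [cite: BorceaBranden2009, §5.1 proof of Lemma 5.2 ("the first operator is a composition of
the second operator and a rescaling of the variables")] -/
theorem mvMultiplierOp_comp_scaleOp (b : (τ →₀ ℕ) → ℂ) (c : τ → ℝ) :
    mvMultiplierOp b ∘ₗ (scaleOp c).toLinearMap =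
      mvMultiplierOp fun s => b s * ∏ i, ((c i : ℝ) : ℂ) ^ s i := by
  refine (basisMonomials τ ℂ).ext fun s => ?_
  rw [LinearMap.comp_apply, AlgHom.toLinearMap_apply, coe_basisMonomials, scaleOp_monomial, map_smul,
    mvMultiplierOp_monomial, mvMultiplierOp_monomial, smul_monomial, smul_eq_mul]
  congr 1
  ring

end Scale

/-! ## §4 The multipliers `J(α,β)` — Lemma 5.2, first operator -/

section Jensen

variable [Fintype τ]

/-- **`J(α,β) = (β)_α β^{-α} = Π_i (β_i)_{α_i} β_i^{-α_i}`** with the convention `0^{±0} = 1` (so the factor is `1`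
when `β_i = α_i = 0`, and `0` when `β_i < α_i`; Lean's `x / 0 = 0` and `0 ^ 0 = 1` realise exactly this).
[cite: BorceaBranden2009, §5.1 (definition of `J(α,β)`, "we use the convention that `k^{±k} = 1` for `k = 0`")] -/
def jensenJ (R : Type*) [Field R] (α β : τ → ℕ) : R :=
  ∏ i, (((β i).descFactorial (α i) : ℕ) : R) / ((β i : R) ^ α i)

/-- For `n = 1` and `α ≤ β` these are the classical Jensen multipliers `β!/((β-α)! β^α)`.
[cite: BorceaBranden2009, §5.1 ("For `n = 1` these are the so-called Jensen multipliers")] -/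
theorem jensenJ_eq_prod_div (R : Type*) [Field R] {α β : τ → ℕ} (h : α ≤ β) :
    jensenJ R α β = ∏ i, (((β i).factorial / (β i - α i).factorial : ℕ) : R) / ((β i : R) ^ α i) :=
  prod_congr rfl fun i _ => by rw [Nat.descFactorial_eq_div (h i)]

/-- `J(α,β) = 0` unless `α ≤ β`. [cite: BorceaBranden2009, §5.1 (definition of `J(α,β)`)] -/
theorem jensenJ_eq_zero (R : Type*) [Field R] {α β : τ → ℕ} (h : ¬ α ≤ β) : jensenJ R α β = 0 := by
  obtain ⟨i, hi⟩ : ∃ i, β i < α i := by simpa only [Pi.le_def, not_forall, not_le] using h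
  exact prod_eq_zero (mem_univ i) (by rw [Nat.descFactorial_eq_zero_iff_lt.2 hi, Nat.cast_zero, zero_div])

/-- The rescaling constants `1/β_i` (and `1` where `β_i = 0`). [cite: BorceaBranden2009, §5.1 proof of Lemma 5.2
("a rescaling of the variables")] -/
def jensenScale (β : τ → ℕ) (i : τ) : ℝ :=
  if β i = 0 then 1 else (β i : ℝ)⁻¹

omit [Fintype τ] in
/-- The rescaling constants are positive. [cite: BorceaBranden2009, §5.1 proof of Lemma 5.2] -/
theorem jensenScale_pos (β : τ → ℕ) (i : τ) : 0 < jensenScale β i := by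
  unfold jensenScale
  split_ifs with h
  · exact one_pos
  · exact inv_pos.2 (Nat.cast_pos.2 (Nat.pos_of_ne_zero h))

/-- **`J(α,β) = (β)_α · Π_i (1/β_i)^{α_i}`** (with `1/β_i` read as `1` when `β_i = 0`: then either `α_i = 0` or
`(β)_α = 0`). [cite: BorceaBranden2009, §5.1 proof of Lemma 5.2 ("the first operator is a composition of the second
operator and a rescaling of the variables")] -/
theorem jensenJ_eq_mul_prod (α β : τ → ℕ) :
    jensenJ ℂ α β = (∏ i, (((β i).descFactorial (α i) : ℕ) : ℂ)) * ∏ i, ((jensenScale β i : ℝ) : ℂ) ^ α i := by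
  rw [jensenJ, ← prod_mul_distrib]
  refine prod_congr rfl fun i _ => ?_
  unfold jensenScale
  by_cases hβ : β i = 0
  · rw [if_pos hβ, hβ, Complex.ofReal_one, one_pow, mul_one, Nat.cast_zero]
    rcases Nat.eq_zero_or_pos (α i) with hα | hα
    · rw [hα, pow_zero, div_one]
    · rw [Nat.descFactorial_eq_zero_iff_lt.2 hα, Nat.cast_zero, zero_div]
  · rw [if_neg hβ, Complex.ofReal_inv, Complex.ofReal_natCast, inv_pow, div_eq_mul_inv]

/-- **The first operator of Lemma 5.2, `z^α ↦ J(α,β) z^α`.** [cite: BorceaBranden2009, §5.1 Lemma 5.2 (first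
operator)] -/
def jensenOp (R : Type*) [Field R] (β : τ → ℕ) : MvPolynomial τ R →ₗ[R] MvPolynomial τ R :=
  mvMultiplierOp fun s => jensenJ R (⇑s) β

/-- `z^α ↦ J(α,β) z^α` on monomials. [cite: BorceaBranden2009, §5.1 Lemma 5.2 (first operator)] -/
theorem jensenOp_monomial (R : Type*) [Field R] (β : τ → ℕ) (s : τ →₀ ℕ) (c : R) :
    jensenOp R β (monomial s c) = monomial s (jensenJ R (⇑s) β * c) :=
  mvMultiplierOp_monomial _ s c

/-- **"The first operator is a composition of the second operator and a rescaling of the variables"**: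
`(z^α ↦ J(α,β) z^α) = (z^α ↦ (β)_α z^α) ∘ (z_i ↦ z_i/β_i)`. [cite: BorceaBranden2009, §5.1 proof of Lemma 5.2] -/
theorem jensenOp_eq_comp (β : τ → ℕ) :
    jensenOp ℂ β = descFactorialOp ℂ β ∘ₗ (scaleOp (jensenScale β)).toLinearMap := by
  rw [descFactorialOp, mvMultiplierOp_comp_scaleOp, jensenOp]
  congr 1
  funext s
  exact jensenJ_eq_mul_prod (⇑s) β

variable [DecidableEq τ]

/-- **Borcea–Brändén I, Lemma 5.2 (first operator), every number of variables: `z^α ↦ J(α,β) z^α` preserves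
stability** — for every `β ∈ ℕ^τ` and every stable `p ∈ ℂ[z_τ]`, `Σ_α J(α,β) a_α z^α` is stable or identically
zero. [cite: BorceaBranden2009, §5.1 Lemma 5.2] -/
theorem jensenOp_stable_or_zero (β : τ → ℕ) {p : MvPolynomial τ ℂ} (hs : IsUpperHalfPlaneStable p) :
    IsUpperHalfPlaneStable (jensenOp ℂ β p) ∨ jensenOp ℂ β p = 0 := by
  rw [jensenOp_eq_comp, LinearMap.comp_apply, AlgHom.toLinearMap_apply]
  exact descFactorialOp_stable_or_zero β (isUpperHalfPlaneStable_scaleOp (jensenScale_pos β) hs)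

end Jensen

/-! ## §5 Real coefficients -/

section Real

/-- **Complexifying a real diagonal operator gives the diagonal operator with the same (real) multipliers.**
[cite: BorceaBranden2009, §4 proof of Thm. 1.2 (complexification `T_ℂ`)] -/
theorem complexify_mvMultiplierOp (b : (τ →₀ ℕ) → ℝ) :
    complexify (mvMultiplierOp b) = mvMultiplierOp fun s => ((b s : ℝ) : ℂ) := by
  refine (basisMonomials τ ℂ).ext fun s => ?_
  rw [coe_basisMonomials, complexify_monomial, one_smul, mvMultiplierOp_monomial, mvMultiplierOp_monomial,
    map_monomial, mul_one, mul_one]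
  rfl

/-- `(z^α ↦ b(α) z^α)` commutes with complexification for real multipliers.
[cite: BorceaBranden2009, §4 proof of Thm. 1.2] -/
theorem map_mvMultiplierOp (b : (τ →₀ ℕ) → ℝ) (p : MvPolynomial τ ℝ) :
    map (algebraMap ℝ ℂ) (mvMultiplierOp b p) = mvMultiplierOp (fun s => ((b s : ℝ) : ℂ)) (map (algebraMap ℝ ℂ) p) := by
  rw [← complexify_mvMultiplierOp, complexify_map]

/-- **A real diagonal operator whose complexification preserves stability preserves real stability.**
[cite: BorceaBranden2009, §1 (real stable = stable with real coefficients)] -/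
theorem isRealStable_mvMultiplierOp_or_zero {b : (τ →₀ ℕ) → ℝ} {b' : (τ →₀ ℕ) → ℂ}
    (hb : ∀ s, ((b s : ℝ) : ℂ) = b' s)
    (h : ∀ q : MvPolynomial τ ℂ, IsUpperHalfPlaneStable q →
      IsUpperHalfPlaneStable (mvMultiplierOp b' q) ∨ mvMultiplierOp b' q = 0)
    {p : MvPolynomial τ ℝ} (hp : IsRealStable p) :
    IsRealStable (mvMultiplierOp b p) ∨ mvMultiplierOp b p = 0 := by
  have hb' : (fun s => ((b s : ℝ) : ℂ)) = b' := funext hb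
  rcases h (map (algebraMap ℝ ℂ) p) hp with h1 | h1
  · rw [← hb', ← map_mvMultiplierOp] at h1
    exact Or.inl h1
  · rw [← hb', ← map_mvMultiplierOp] at h1
    exact Or.inr (map_injective (algebraMap ℝ ℂ) (algebraMap ℝ ℂ).injective (by rw [h1, map_zero]))

variable [Fintype τ] [DecidableEq τ]

/-- **Lemma 5.2 (second operator) for real stability**: `z^α ↦ (β)_α z^α` maps real stable polynomials to real
stable polynomials or to `0`. [cite: BorceaBranden2009, §5.1 Lemma 5.2 (with §5, first paragraph: "the arguments
are the same for `𝕂 = ℝ` and `𝕂 = ℂ`")] -/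
theorem descFactorialOp_realStable_or_zero (β : τ → ℕ) {p : MvPolynomial τ ℝ} (hp : IsRealStable p) :
    IsRealStable (descFactorialOp ℝ β p) ∨ descFactorialOp ℝ β p = 0 := by
  unfold descFactorialOp
  refine isRealStable_mvMultiplierOp_or_zero (b' := fun s => ∏ i, (((β i).descFactorial (s i) : ℕ) : ℂ))
    (fun s => ?_) (fun q hq => descFactorialOp_stable_or_zero β hq) hp
  rw [Complex.ofReal_prod]
  exact prod_congr rfl fun i _ => Complex.ofReal_natCast _

/-- **Lemma 5.2 (first operator) for real stability**: `z^α ↦ J(α,β) z^α` maps real stable polynomials to real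
stable polynomials or to `0` (`J(α,β)` is real). [cite: BorceaBranden2009, §5.1 Lemma 5.2 (with §5, first
paragraph)] -/
theorem jensenOp_realStable_or_zero (β : τ → ℕ) {p : MvPolynomial τ ℝ} (hp : IsRealStable p) :
    IsRealStable (jensenOp ℝ β p) ∨ jensenOp ℝ β p = 0 := by
  unfold jensenOp
  refine isRealStable_mvMultiplierOp_or_zero (b' := fun s => jensenJ ℂ (⇑s) β)
    (fun s => ?_) (fun q hq => jensenOp_stable_or_zero β hq) hp
  rw [jensenJ, jensenJ, Complex.ofReal_prod]
  exact prod_congr rfl fun i _ => by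
    rw [Complex.ofReal_div, Complex.ofReal_pow, Complex.ofReal_natCast, Complex.ofReal_natCast]

end Real

end Literature.Combinatorics.StablePolynomials

end
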